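import Summits.ABC.IUTFork.Cor312ThetaSlotM
import Summits.ABC.IUTFork.Cor312GenuineThetaPerImageIdentification
import Summits.ABC.IUTFork.Cor312ThetaSideExactAssemblyM
import Summits.ABC.IUTFork.Cor312SlotHullJunction
import HarnessLib

/-!
# [IUTchIII] Cor. 3.12 IN READING (P) at the M-LEVEL sharp setting of the datum's OWN Θ-ideles — NONARCHIMEDEAN EXACTNESS, UNCONDITIONAL:
# `−|log(Θ)|^{(P)}(settingPrVolSharpM … (tOfIdeleData D r) …) = ↑(volumeInputOf D r).negLogThetaPerImageNonarch ≤ ↑(volumeInputOf D r).negLogThetaPerImage`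

PROOF-ONLY file (D-0012; no definitions, no `Prop` facts) of the abc-iut cell (branch C certificate seat abc-iut-C-cert-2 gen 4; the M-LEVEL SLOT
READ, part 3/3). TAKES NO SIDE on [IUTchIII] Cor. 3.12 or on the reading (U)/(P) of `−|log(Θ)|`. DISCHARGES, on the M line (summand route, genuine
carriers `K_{v̲}`, the datum's OWN ideles), the READ-P binder «`negLogThetaSlot (M setting) ≤ ↑T.negLogThetaPerImage`» that the M twins of this
seat's γ / joint certificates (`Conditional.abc_of_slotLicence_orNumP_K_*`, `Conditional.abc_of_jointLicence_K_*`) need — the M-level twin of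
abc-iut-s2-p7's `Cor312ThetaSlotExactK` (p462135) / `Cor312ThetaSlotExactKDatum` (p462377), by the method of abc-iut-s2-p8's
`Cor312ThetaSideExactAssemblyM` (p448468: `−|log(Θ)|` from local EQUALITIES, one place of `ℚ` per prime of the support):

* §1 (generic, any `Cor312.Setting`): `coe_logvol_thetaRegion3_le_thetaSlotLocal` — under monotone log-volume, where the slot hull is defined the slot
  term is at least the log-volume of the (Ind3)-region (which lies in the slot hull); the upper companion `thetaSlotLocal_le_thetaLocal` (slot term ≤
  full term) is abc-iut-s2-p2's (`Cor312SlotHullJunction`, p464035), imported;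
* §2 at `settingPrVolSharpM … (tOfIdeleData D r) …`: `thetaSlotLocal_settingPrVolSharpM_tOfIdeleData_eq_zero_of_not_mem_support` (off the support
  `T(I)` the slot term is squeezed between the region's log-volume `Σ Pr·log‖t‖ = 0` (unit ideles, abc-iut-s2-p8 `logvol_thetaRegion3_settingPrVolSharpM_non`)
  and the full term `= 0` (abc-iut-w5-d166 `thetaLocal_settingMSharp_tOfIdeleData_eq_zero`); [IUTchIV] Thm. 1.10 Step (vi));
  **`negLogThetaSlot_settingPrVolSharpM_tOfIdeleData_eq_negLogThetaPerImageNonarch`** — `= ↑(volumeInputOf D r).negLogThetaPerImageNonarch`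
  (part 1/3 `thetaSlotLocal_settingPrVolSharpM_eq_sum_orbitHull` per packet; part 2/3 `procAvg_sum_fibre_weightM_lastSlotOrbitHull_eq_negLogThetaPerImageLoc`
  per prime; abc-iut-C-cert-2 `negLogThetaSlot_eq_of_thetaSlotLocal_eq` sums); `thetaSlotFinite_settingPrVolSharpM_tOfIdeleData`;
  **`negLogThetaSlot_settingPrVolSharpM_tOfIdeleData_le_negLogThetaPerImage`** (`+ ((l+5)/4)·log π > 0`, abc-iut-S2 `archLogTheta_pos`) and the
  `IsVolumeInputOf` forms `…_of_isVolumeInputOf` (abc-iut-w5-d033 `eq_volumeInputOf_ideleDataOf`) — LITERALLY the READ-P binder at a genuine datum.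

[cite: Mochizuki2012, IUTchIII Cor. 3.12 p. 173–174, proof Step (x) p. 181; Thm. 3.11 (i) (Ind2) p. 154] [cite: Mochizuki2012, IUTchIV Thm. 1.10 Steps
(v)–(viii) p. 27–31] [cite: Mochizuki2012, IUTchI Def. 3.1 (e) p. 62] [cite: DupuyHilado2025, Def. 3.6.3, §3.9, §4.9, §4.11–4.12] [claim: Mochizuki2012,
status: disputed] for every quoted construction. HONEST FRAMING: an identity between OUR two typings of the per-image nonarchimedean quantity (sharp (Ind3)
reading, factorwise (Ind2), trivial archimedean container) at the genuine carriers; reading (P) is STRONGER than print's hull of the union of ALL possible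
images; nothing here asserts or denies Cor. 3.12 for any initial Θ-data or takes a side on any author; typed ≠ proved; instantiated ≠ endorsed.
-/

noncomputable section

open Set Function NumberField IsDedekindDomain
open scoped Pointwise Classical

/-! ## §1. Generic: the slot term between the region's log-volume and the full term -/

namespace Summit.ABC.IUTFork.Cor312.Setting

open Thm311 Cor312Vol Literature.IUT.LogThetaLattice

variable {T : ThetaIndex} {S : Situation T} (P : Setting S)

/-- **`log-vol((Ind3)-region) ≤ −|log(Θ)|^{(P)}_{j,v_ℚ}`**: under a monotone log-volume, where the slot hull is defined and the region is admissible, the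
region's log-volume is at most the slot term (the region lies in the slot hull, `thetaRegion3_subset_thetaSlotHull`).
[cite: Mochizuki2012, IUTchIII Prop. 3.9 (ii) p. 126] [cite: DupuyHilado2025, §4.11–4.12] -/
theorem coe_logvol_thetaRegion3_le_thetaSlotLocal (hmono : LogvolMono P) (i : Fin T.lstar) (vQ : T.VQ)
    (hsdef : P.SlotHullDefined (labelSucc i) vQ) (hadm : (S.D P.n).Adm (labelSucc i) vQ (P.thetaRegion3 (labelSucc i) vQ)) :
    (((S.D P.n).logvol (labelSucc i) vQ (P.thetaRegion3 (labelSucc i) vQ) : ℝ) : WithTop ℝ) ≤ P.thetaSlotLocal (labelSucc i) vQ := by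
  rw [P.thetaSlotLocal_eq_coe hsdef]
  exact WithTop.coe_le_coe.mpr (hmono i vQ hadm (P.thetaSlotHull_adm hsdef) (P.thetaRegion3_subset_thetaSlotHull _ vQ))

end Summit.ABC.IUTFork.Cor312.Setting

namespace Summit.ABC.IUTFork.Thm311.Real

open Cor312 Cor312Vol Literature.IUT.LogThetaLattice Literature.IUT.LogVolume Literature.IUT.HodgeTheaters
  Literature.NumberTheory.NumberFields

variable {F K Fbar : Type} [Field F] [NumberField F] [Field K] [NumberField K] [Algebra F K]
  [Field Fbar] [Algebra F Fbar] [Algebra K Fbar] {E : WeierstrassCurve F} [E.IsElliptic] {l : ℕ}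
  {Pb : BadPlacePredicates K} (D : InitialThetaData F K Fbar E l Pb) {logvK : PadicLogsVal K}
  (hlog : LogvAnalyticVal logvK) (r : ThetaData.IdeleData D)
  (tq : ∀ (u : FinitePlace ℚ) (x : (thetaIndexOfInitial D).Fibre (Val.non u)),
    kOfM D (ratChar u) u (natCast_ratChar_mem u) x)
  (M : Type) [Field M] [NumberField M]
  (archPk : ∀ (j : (thetaIndexOfInitial D).Label) (vQ : (thetaIndexOfInitial D).VQ),
    Set ((logShellsOfInitialDH D logvK).Packet j vQ))
  (archSub : ∀ (j : (thetaIndexOfInitial D).Label) (v : (thetaIndexOfInitial D).V),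
    Set ((logShellsOfInitialDH D logvK).Packet j ((thetaIndexOfInitial D).over v)))
  (Ψ : ℤ → ∀ v : (thetaIndexOfInitial D).V, v ∈ (thetaIndexOfInitial D).Vbad →
    Set ((logShellsOfInitialDH D logvK).StarPacket v))
  (act : ℤ → ∀ v : (thetaIndexOfInitial D).V, v ∈ (thetaIndexOfInitial D).Vbad →
    (logShellsOfInitialDH D logvK).StarPacket v → Module.End ℚ ((logShellsOfInitialDH D logvK).StarPacket v))
  (Mmod : ℤ → ∀ j : (thetaIndexOfInitial D).LabelStar, Set ((logShellsOfInitialDH D logvK).GlobalPacket j.1))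
  (region : ℤ → ∀ j : (thetaIndexOfInitial D).LabelStar, FinDivisor M → ∀ vQ : (thetaIndexOfInitial D).VQ,
    Set ((logShellsOfInitialDH D logvK).Packet j.1 vQ))
  (n : ℤ) {HT : Type} {LogLink : HT → HT → Type} {IsFull : ∀ {s t : HT}, LogLink s t → Prop}
  (lat : LGPGaussianLogThetaLattice LogLink IsFull)
  {Frd : Type} {IsoF : Frd → Frd → Type} {Ob : Frd → Type} {realify : Frd → Frd} {Strip : Type}
  {IsoS : Strip → Strip → Type}
  {Mv : ∀ v : (thetaIndexOfInitial D).V, v ∈ (thetaIndexOfInitial D).Vbad → Type} [∀ v h, Monoid (Mv v h)]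
  (sig : GlobalLGPFrobenioidSignature (thetaIndexOfInitial D).lstar (thetaIndexOfInitial D).V
    (· ∈ (thetaIndexOfInitial D).Vbad) Frd IsoF Ob realify Strip IsoS Mv)
  (split : SplittingMonoids Mv) {ObΔ : Type}
  {N : ∀ v : (thetaIndexOfInitial D).V, v ∈ (thetaIndexOfInitial D).Vbad → Type} [∀ v h, Monoid (N v h)]
  (qData : QPilotData ObΔ N)
  (htq0 : ∀ u x, tq u x ≠ 0) (Sq : Finset (FinitePlace ℚ))
  (htq1 : ∀ (u : FinitePlace ℚ) (x : (thetaIndexOfInitial D).Fibre (Val.non u)), u ∉ Sq → ‖tq u x‖ = 1)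

/-! ## §2. At the summand-route M-level sharp setting of the datum's OWN Θ-ideles -/

/-- Off the image of `V^bad_mod` the read-off Θ-ideles are units (abc-iut-w5-d033 `norm_tThetaM_eq_one_of_not_mem_image`, VERBATIM `ht1` shape).
[cite: DupuyHilado2025, §3.3, §3.9] -/
theorem norm_tOfIdeleData_eq_one_of_not_mem_image_badPrimesMod (u : FinitePlace ℚ) (i : Fin (thetaIndexOfInitial D).lstar)
    (x : (thetaIndexOfInitial D).Fibre (Val.non u))
    (hu : u ∉ (ThetaData.badPrimesMod D).image fun v => FinitePlace.mk (v.under (𝓞 ℚ))) : ‖tOfIdeleData D r u i x‖ = 1 :=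
  norm_tThetaM_eq_one_of_not_mem_image D (ratChar u) u (natCast_ratChar_mem u) r i x hu

/-- **THE LOCAL SLOT TERM at the datum's own Θ-ideles, orbit form** (part 1/3 `thetaSlotLocal_settingPrVolSharpM_eq_sum_orbitHull` with the idele side
conditions DISCHARGED: `tOfIdeleData_ne_zero`, units off the image of `V^bad_mod`): `−|log(Θ)|^{(P)}_{i+1,u} = ↑(Σ_{v⃗'} Pr(v⃗')·log μ̄_{v⃗'}(hull(Ind2·ι_{i+1}(t_{Θ,i,v̲'_{i+1}})·(R_I)^∼)))`.
[cite: Mochizuki2012, IUTchIII Cor. 3.12 proof Step (x) p. 181] [cite: DupuyHilado2025, §4.9, §4.12] -/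
theorem thetaSlotLocal_settingPrVolSharpM_tOfIdeleData_eq_sum_orbitHull (i : Fin (thetaIndexOfInitial D).lstar) (u : FinitePlace ℚ)
    [Fintype ((thetaIndexOfInitial D).Fibre (Val.non u))] :
    (settingPrVolSharpM D hlog (tOfIdeleData D r) tq M archPk archSub Ψ act Mmod region n lat sig split qData htq0 Sq htq1).thetaSlotLocal
        (Setting.labelSucc i) (Val.non u) =
      ((∑ e' : Fin ((i : ℕ) + 1 + 1) → (thetaIndexOfInitial D).Fibre (Val.non u),
          weightM D u (Fin.succ i) e' *
            packetLogμ (ratChar u) (fun b => kOfM D (ratChar u) u (natCast_ratChar_mem u) (e' b))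
              (packetHull (ratChar u) (fun b => kOfM D (ratChar u) u (natCast_ratChar_mem u) (e' b))
                (⋃ g : indTwo (ratChar u) (fun b => kOfM D (ratChar u) u (natCast_ratChar_mem u) (e' b)),
                  g • iota (ratChar u) (fun b => kOfM D (ratChar u) u (natCast_ratChar_mem u) (e' b)) (Fin.last _)
                      (tThetaM D (ratChar u) u (natCast_ratChar_mem u) r i (e' (Fin.last _))) •
                    (normalizedPacket (ratChar u) (fun b => kOfM D (ratChar u) u (natCast_ratChar_mem u) (e' b)) :
                      Set (PacketAlgebra (ratChar u) (fun b => kOfM D (ratChar u) u (natCast_ratChar_mem u) (e' b)))))) : ℝ) :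
        WithTop ℝ) :=
  thetaSlotLocal_settingPrVolSharpM_eq_sum_orbitHull D hlog (tOfIdeleData D r) tq M archPk archSub Ψ act Mmod region n lat sig split qData
    htq0 Sq htq1 (tOfIdeleData_ne_zero D r) _ (fun u i x hu => norm_tOfIdeleData_eq_one_of_not_mem_image_badPrimesMod D r u i x hu) i u

/-- **The procession average of the local slot terms at `u` IS abc-iut-S7's `negLogThetaPerImageLoc p_u`** (part 2/3 at `p := p_u`).
[cite: Mochizuki2012, IUTchIII Cor. 3.12 proof Step (x) p. 181] [cite: DupuyHilado2025, Def. 3.6.3, §4.12] -/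
theorem procAvg_sum_lastSlotOrbitHull_ratChar_eq_negLogThetaPerImageLoc (u : FinitePlace ℚ)
    [Fintype ((thetaIndexOfInitial D).Fibre (Val.non u))] :
    (1 / ((thetaIndexOfInitial D).lstar : ℝ)) * ∑ i : Fin (thetaIndexOfInitial D).lstar,
      (∑ e' : Fin ((i : ℕ) + 1 + 1) → (thetaIndexOfInitial D).Fibre (Val.non u),
        weightM D u (Fin.succ i) e' *
          packetLogμ (ratChar u) (fun b => kOfM D (ratChar u) u (natCast_ratChar_mem u) (e' b))
            (packetHull (ratChar u) (fun b => kOfM D (ratChar u) u (natCast_ratChar_mem u) (e' b))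
              (⋃ g : indTwo (ratChar u) (fun b => kOfM D (ratChar u) u (natCast_ratChar_mem u) (e' b)),
                g • iota (ratChar u) (fun b => kOfM D (ratChar u) u (natCast_ratChar_mem u) (e' b)) (Fin.last _)
                    (tThetaM D (ratChar u) u (natCast_ratChar_mem u) r i (e' (Fin.last _))) •
                  (normalizedPacket (ratChar u) (fun b => kOfM D (ratChar u) u (natCast_ratChar_mem u) (e' b)) :
                    Set (PacketAlgebra (ratChar u) (fun b => kOfM D (ratChar u) u (natCast_ratChar_mem u) (e' b))))))) =
      (ThetaData.volumeInputOf D r).negLogThetaPerImageLoc (ratChar u) :=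
  procAvg_sum_fibre_weightM_lastSlotOrbitHull_eq_negLogThetaPerImageLoc D (ratChar u) u (natCast_ratChar_mem u) r

/-- **Off the support the slot term VANISHES** ([IUTchIV] Thm. 1.10 Step (vi), reading (P)): at a finite place `u` whose prime lies outside `T(I)` of the
genuine input `volumeInputOf D r`, the local slot term of `settingPrVolSharpM … (tOfIdeleData D r) …` is `0` — squeezed between the log-volume of the
(Ind3)-region, `Σ_{v⃗'} Pr(v⃗')·log‖t_{Θ,i,v̲'_{i+1}}‖ = 0` (unit ideles off the support; abc-iut-s2-p8 `logvol_thetaRegion3_settingPrVolSharpM_non`), and the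
full term, `= 0` there (abc-iut-w5-d166 `thetaLocal_settingMSharp_tOfIdeleData_eq_zero` through abc-iut-w4-d013's two-routes identity).
[cite: Mochizuki2012, IUTchIV Thm. 1.10 Step (vi) p. 29] [cite: DupuyHilado2025, §3.9] -/
theorem thetaSlotLocal_settingPrVolSharpM_tOfIdeleData_eq_zero_of_not_mem_support (i : Fin (thetaIndexOfInitial D).lstar)
    (u : FinitePlace ℚ) (hu : ratChar u ∉ (ThetaData.volumeInputOf D r).supportPrimes) :
    (settingPrVolSharpM D hlog (tOfIdeleData D r) tq M archPk archSub Ψ act Mmod region n lat sig split qData htq0 Sq htq1).thetaSlotLocal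
        (Setting.labelSucc i) (Val.non u) = ((0 : ℝ) : WithTop ℝ) := by
  have hB := bridgeHyps_settingPrVolSharpM_of_ideles D hlog (tOfIdeleData D r) tq M archPk archSub Ψ act Mmod region n lat sig split qData
    htq0 Sq htq1 (tOfIdeleData_ne_zero D r) _ (fun u i x hu => norm_tOfIdeleData_eq_one_of_not_mem_image_badPrimesMod D r u i x hu)
  have hsdef := slotHullDefined_settingPrVolSharpM_non D hlog (tOfIdeleData D r) tq M archPk archSub Ψ act Mmod region n lat sig split
    qData htq0 Sq htq1 (tOfIdeleData_ne_zero D r) _ (fun u i x hu => norm_tOfIdeleData_eq_one_of_not_mem_image_badPrimesMod D r u i x hu) i u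
  -- the ideles of the label are units at `u` (off the support ⊇ image of the bad places)
  have hS : ratChar u ∉ (ThetaData.pilotData D).S.image (residueChar (fieldOfModuli E)) := fun h =>
    hu (Finset.mem_union_right _ h)
  have h1 : ∀ x : (thetaIndexOfInitial D).Fibre (Val.non u), ‖tOfIdeleData D r u i x‖ = 1 :=
    norm_tOfIdeleData_eq_one_of_not_mem D r u hS i
  refine le_antisymm ?_ ?_
  · -- ≤ the full term `= 0`
    refine ((settingPrVolSharpM D hlog (tOfIdeleData D r) tq M archPk archSub Ψ act Mmod region n lat sig split qData htq0 Sq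
      htq1).thetaSlotLocal_le_thetaLocal hB.mono i _ hsdef).trans (le_of_eq ?_)
    rw [← thetaLocal_settingMSharp_eq_settingPrVolSharpM]
    exact thetaLocal_settingMSharp_tOfIdeleData_eq_zero D hlog r M archPk archSub Ψ act Mmod region n lat sig split qData tq htq0 Sq
      htq1 i u hu
  · -- ≥ the region's log-volume `= 0`
    refine (le_of_eq ?_).trans ((settingPrVolSharpM D hlog (tOfIdeleData D r) tq M archPk archSub Ψ act Mmod region n lat sig split
      qData htq0 Sq htq1).coe_logvol_thetaRegion3_le_thetaSlotLocal hB.mono i _ hsdef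
      (adm_thetaRegion3_settingPrVolSharpM D hlog (tOfIdeleData D r) tq M archPk archSub Ψ act Mmod region n lat sig split qData htq0 Sq
        htq1 (tOfIdeleData_ne_zero D r) _ _))
    congr 1
    rw [settingPrVolSharpM_n, logvol_thetaRegion3_settingPrVolSharpM_non D hlog (tOfIdeleData D r) tq M archPk archSub Ψ act Mmod region n
      lat sig split qData htq0 Sq htq1 (tOfIdeleData_ne_zero D r) i u]
    exact (Finset.sum_eq_zero fun e _ => by rw [h1, Real.log_one, mul_zero]).symm

/-- **NONARCHIMEDEAN EXACTNESS IN READING (P) ON THE M LINE — `−|log(Θ)|^{(P)}(settingPrVolSharpM … (tOfIdeleData D r) …) = ↑(volumeInputOf D r).negLogThetaPerImageNonarch`**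
for the initial Θ-data `D` and idele data `r` (ANY `q`-ideles `tq` non-zero and units off `Sq`, any context data and column): at the archimedean place the slot
term is `0` (part 1/3), off `T(I)` it is `0` (Step (vi) above), at `u ∣ p ∈ T(I)` its procession average IS `negLogThetaPerImageLoc p` (parts 1/3 + 2/3); summed
place-first by abc-iut-C-cert-2's `negLogThetaSlot_eq_of_thetaSlotLocal_eq` over one place of `ℚ` per prime of `T(I)` (abc-iut-w5-d166 `placeOfPrimeQ`).
The M-level twin of abc-iut-s2-p7's `negLogThetaSlot_settingPrVolSharp_pilotDataOfK_eq_negLogThetaPerImageNonarch`.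
[cite: Mochizuki2012, IUTchIII Cor. 3.12 proof Step (x) p. 181] [cite: Mochizuki2012, IUTchIV Thm. 1.10 Steps (v)–(viii) p. 27–31]
[cite: DupuyHilado2025, Def. 3.6.3, §4.11–4.12] -/
theorem negLogThetaSlot_settingPrVolSharpM_tOfIdeleData_eq_negLogThetaPerImageNonarch :
    (settingPrVolSharpM D hlog (tOfIdeleData D r) tq M archPk archSub Ψ act Mmod region n lat sig split qData htq0 Sq htq1).negLogThetaSlot =
      (((ThetaData.volumeInputOf D r).negLogThetaPerImageNonarch : ℝ) : WithTop ℝ) := by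
  set I := ThetaData.volumeInputOf D r with hI
  set P := settingPrVolSharpM D hlog (tOfIdeleData D r) tq M archPk archSub Ψ act Mmod region n lat sig split qData htq0 Sq htq1 with hP
  -- the finite set of places of `ℚ` under the support, one per prime
  let φ : {q // q ∈ I.supportPrimes} → (thetaIndexOfInitial D).VQ :=
    fun q => Val.non (placeOfPrimeQ q.1 (I.prime_of_mem_supportPrimes q.2))
  have hφ : Function.Injective φ := by
    intro q q' h
    have h1 : placeOfPrimeQ q.1 (I.prime_of_mem_supportPrimes q.2) =
        placeOfPrimeQ q'.1 (I.prime_of_mem_supportPrimes q'.2) := Sum.inr_injective h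
    apply Subtype.ext
    rw [← ratChar_placeOfPrimeQ q.1 (I.prime_of_mem_supportPrimes q.2), h1,
      ratChar_placeOfPrimeQ q'.1 (I.prime_of_mem_supportPrimes q'.2)]
  let Tset : Finset (thetaIndexOfInitial D).VQ := Finset.univ.image φ
  -- the local values: last-slot orbit-hull sums at finite places, `0` at the archimedean place
  let b : Fin (thetaIndexOfInitial D).lstar → (thetaIndexOfInitial D).VQ → ℝ := fun i vQ =>
    match vQ with
    | .inr u =>
      letI : Fintype ((thetaIndexOfInitial D).Fibre (Val.non u)) := Fintype.ofFinite _
      ∑ e' : Fin ((i : ℕ) + 1 + 1) → (thetaIndexOfInitial D).Fibre (Val.non u),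
        weightM D u (Fin.succ i) e' *
          packetLogμ (ratChar u) (fun b => kOfM D (ratChar u) u (natCast_ratChar_mem u) (e' b))
            (packetHull (ratChar u) (fun b => kOfM D (ratChar u) u (natCast_ratChar_mem u) (e' b))
              (⋃ g : indTwo (ratChar u) (fun b => kOfM D (ratChar u) u (natCast_ratChar_mem u) (e' b)),
                g • iota (ratChar u) (fun b => kOfM D (ratChar u) u (natCast_ratChar_mem u) (e' b)) (Fin.last _)
                    (tThetaM D (ratChar u) u (natCast_ratChar_mem u) r i (e' (Fin.last _))) •
                  (normalizedPacket (ratChar u) (fun b => kOfM D (ratChar u) u (natCast_ratChar_mem u) (e' b)) :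
                    Set (PacketAlgebra (ratChar u) (fun b => kOfM D (ratChar u) u (natCast_ratChar_mem u) (e' b))))))
    | .inl _ => 0
  have hnon : ∀ (i : Fin (thetaIndexOfInitial D).lstar) (u : FinitePlace ℚ),
      P.thetaSlotLocal (Setting.labelSucc i) (Val.non u) = ((b i (Val.non u) : ℝ) : WithTop ℝ) := by
    intro i u
    letI : Fintype ((thetaIndexOfInitial D).Fibre (Val.non u)) := Fintype.ofFinite _
    rw [hP, thetaSlotLocal_settingPrVolSharpM_tOfIdeleData_eq_sum_orbitHull D hlog r tq M archPk archSub Ψ act Mmod region n lat sig split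
      qData htq0 Sq htq1 i u]
    rfl
  have heq : ∀ (i : Fin (thetaIndexOfInitial D).lstar), ∀ vQ ∈ Tset,
      P.thetaSlotLocal (Setting.labelSucc i) vQ = ((b i vQ : ℝ) : WithTop ℝ) := by
    intro i vQ hvQ
    obtain ⟨q, -, rfl⟩ := Finset.mem_image.mp hvQ
    exact hnon i _
  have hzero : ∀ (i : Fin (thetaIndexOfInitial D).lstar) (vQ : (thetaIndexOfInitial D).VQ), vQ ∉ Tset →
      P.thetaSlotLocal (Setting.labelSucc i) vQ = ((0 : ℝ) : WithTop ℝ) := by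
    intro i vQ hvQ
    rcases vQ with w | u
    · exact thetaSlotLocal_settingPrVolSharpM_arc_eq_zero D hlog (tOfIdeleData D r) tq M archPk archSub Ψ act Mmod region n lat sig split
        qData htq0 Sq htq1 (Setting.labelSucc i) w
    · have hu : ratChar u ∉ I.supportPrimes := by
        intro hmem
        apply hvQ
        refine Finset.mem_image.mpr ⟨⟨ratChar u, hmem⟩, Finset.mem_univ _, ?_⟩
        show Val.non (placeOfPrimeQ (ratChar u) _) = Val.non u
        rw [placeOfPrimeQ_ratChar u]
      exact thetaSlotLocal_settingPrVolSharpM_tOfIdeleData_eq_zero_of_not_mem_support D hlog r tq M archPk archSub Ψ act Mmod region n lat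
        sig split qData htq0 Sq htq1 i u hu
  have hmain := P.negLogThetaSlot_eq_of_thetaSlotLocal_eq Tset b hzero heq
  -- the place sum of the averaged slot sums is the nonarchimedean part of the per-image number
  have hsum : (∑ vQ ∈ Tset, (1 / ((thetaIndexOfInitial D).lstar : ℝ)) * ∑ i : Fin (thetaIndexOfInitial D).lstar, b i vQ) =
      I.negLogThetaPerImageNonarch := by
    rw [Finset.sum_image fun q _ q' _ h => hφ h, ThetaVolumeInput.negLogThetaPerImageNonarch, ← Finset.sum_attach I.supportPrimes]
    refine Finset.sum_congr rfl fun q _ => ?_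
    letI : Fintype ((thetaIndexOfInitial D).Fibre (Val.non (placeOfPrimeQ q.1 (I.prime_of_mem_supportPrimes q.2)))) :=
      Fintype.ofFinite _
    have hq := procAvg_sum_lastSlotOrbitHull_ratChar_eq_negLogThetaPerImageLoc D r (placeOfPrimeQ q.1 (I.prime_of_mem_supportPrimes q.2))
    exact hq.trans (congrArg (ThetaData.volumeInputOf D r).negLogThetaPerImageLoc
      (ratChar_placeOfPrimeQ q.1 (I.prime_of_mem_supportPrimes q.2)))
  rw [hsum] at hmain
  exact hmain

/-- Hence **`ThetaSlotFinite`** («`−|log(Θ)|^{(P)} ∈ ℝ`») at the summand-route M-level sharp setting of the datum's own Θ-ideles. [claim: Mochizuki2012, status: disputed] -/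
theorem thetaSlotFinite_settingPrVolSharpM_tOfIdeleData :
    (settingPrVolSharpM D hlog (tOfIdeleData D r) tq M archPk archSub Ψ act Mmod region n lat sig split qData htq0 Sq htq1).ThetaSlotFinite := by
  by_contra h
  have h' := negLogThetaSlot_settingPrVolSharpM_tOfIdeleData_eq_negLogThetaPerImageNonarch D hlog r tq M archPk archSub Ψ act Mmod region n lat
    sig split qData htq0 Sq htq1
  rw [Cor312.Setting.negLogThetaSlot, if_neg h] at h'
  exact WithTop.top_ne_coe h'

/-- **READ-P on the M line — `−|log(Θ)|^{(P)}(settingPrVolSharpM … (tOfIdeleData D r) …) ≤ ↑(volumeInputOf D r).negLogThetaPerImage`**: the exactness above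
plus the archimedean summand `((l+5)/4)·log π > 0` (abc-iut-S2 `archLogTheta_pos`; the setting's archimedean term is `0`, trivial container — the slack of
the READ-P binder is EXACTLY [IUTchIV] Thm. 1.10 Step (vii)'s summand). [cite: Mochizuki2012, IUTchIV Thm. 1.10 Step (vii) p. 30]
[cite: Mochizuki2012, IUTchIII Cor. 3.12 proof Step (x) p. 181] -/
theorem negLogThetaSlot_settingPrVolSharpM_tOfIdeleData_le_negLogThetaPerImage :
    (settingPrVolSharpM D hlog (tOfIdeleData D r) tq M archPk archSub Ψ act Mmod region n lat sig split qData htq0 Sq htq1).negLogThetaSlot ≤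
      (((ThetaData.volumeInputOf D r).negLogThetaPerImage : ℝ) : WithTop ℝ) := by
  rw [negLogThetaSlot_settingPrVolSharpM_tOfIdeleData_eq_negLogThetaPerImageNonarch D hlog r tq M archPk archSub Ψ act Mmod region n lat sig
    split qData htq0 Sq htq1, WithTop.coe_le_coe]
  show (ThetaData.volumeInputOf D r).negLogThetaPerImageNonarch ≤
    (ThetaData.volumeInputOf D r).negLogThetaPerImageNonarch + ThetaVolumeInput.archLogTheta (ThetaData.volumeInputOf D r).l
  exact le_add_of_nonneg_right (ThetaVolumeInput.archLogTheta_pos _).le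

/-- **For a volume input `I` of `D`** (`IsVolumeInputOf D I`: `I = volumeInputOf D (ideleDataOf D hI)`, abc-iut-w5-d033 `eq_volumeInputOf_ideleDataOf`): at the
summand-route M-level sharp setting of `I`'s own Θ-ideles, `−|log(Θ)|^{(P)} = ↑I.negLogThetaPerImageNonarch`. [cite: Mochizuki2012, IUTchIII Cor. 3.12 proof Step (x) p. 181] -/
theorem negLogThetaSlot_settingPrVolSharpM_eq_negLogThetaPerImageNonarch_of_isVolumeInputOf {I : ThetaVolumeInput (fieldOfModuli E) K}
    (hI : ThetaData.IsVolumeInputOf D I) :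
    (settingPrVolSharpM D hlog (tOfIdeleData D (ideleDataOf D hI)) tq M archPk archSub Ψ act Mmod region n lat sig split qData htq0 Sq
        htq1).negLogThetaSlot = ((I.negLogThetaPerImageNonarch : ℝ) : WithTop ℝ) := by
  rw [congrArg ThetaVolumeInput.negLogThetaPerImageNonarch (eq_volumeInputOf_ideleDataOf D hI)]
  exact negLogThetaSlot_settingPrVolSharpM_tOfIdeleData_eq_negLogThetaPerImageNonarch D hlog (ideleDataOf D hI) tq M archPk archSub Ψ act Mmod
    region n lat sig split qData htq0 Sq htq1

/-- **READ-P for a volume input `I` of `D`**: at the summand-route M-level sharp setting of `I`'s own Θ-ideles, `−|log(Θ)|^{(P)} ≤ ↑I.negLogThetaPerImage` — the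
READ-P binder of the M twins of the γ / joint certificates, as a THEOREM. [cite: Mochizuki2012, IUTchIII Cor. 3.12 proof Step (x) p. 181]
[cite: Mochizuki2012, IUTchIV Thm. 1.10 Step (vii) p. 30] -/
theorem negLogThetaSlot_settingPrVolSharpM_le_negLogThetaPerImage_of_isVolumeInputOf {I : ThetaVolumeInput (fieldOfModuli E) K}
    (hI : ThetaData.IsVolumeInputOf D I) :
    (settingPrVolSharpM D hlog (tOfIdeleData D (ideleDataOf D hI)) tq M archPk archSub Ψ act Mmod region n lat sig split qData htq0 Sq
        htq1).negLogThetaSlot ≤ ((I.negLogThetaPerImage : ℝ) : WithTop ℝ) := by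
  rw [congrArg ThetaVolumeInput.negLogThetaPerImage (eq_volumeInputOf_ideleDataOf D hI)]
  exact negLogThetaSlot_settingPrVolSharpM_tOfIdeleData_le_negLogThetaPerImage D hlog (ideleDataOf D hI) tq M archPk archSub Ψ act Mmod region n
    lat sig split qData htq0 Sq htq1

/-- `ThetaSlotFinite` for a volume input `I` of `D` at the M setting of its own Θ-ideles. [claim: Mochizuki2012, status: disputed] -/
theorem thetaSlotFinite_settingPrVolSharpM_of_isVolumeInputOf {I : ThetaVolumeInput (fieldOfModuli E) K}
    (hI : ThetaData.IsVolumeInputOf D I) :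
    (settingPrVolSharpM D hlog (tOfIdeleData D (ideleDataOf D hI)) tq M archPk archSub Ψ act Mmod region n lat sig split qData htq0 Sq
        htq1).ThetaSlotFinite :=
  thetaSlotFinite_settingPrVolSharpM_tOfIdeleData D hlog (ideleDataOf D hI) tq M archPk archSub Ψ act Mmod region n lat sig split qData htq0 Sq
    htq1

end Summit.ABC.IUTFork.Thm311.Real

end
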